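import Summits.BirchSwinnertonDyer.BirchSwinnertonDyer.Theorems.PrintCf2SplitBadTwoInertiaFixedTorsionSharp
import Summits.BirchSwinnertonDyer.BirchSwinnertonDyer.Theorems.PrintCf2SplitBadTwoRestrictedSelmerControlSkeleton
import Literature.NumberTheory.EllipticCurves.HasseWeilGoodReductionFrobeniusProofs
import Literature.NumberTheory.EllipticCurves.LocalFrobeniusGenerationProofs
import HarnessLib

/-!
# Crux `PrintCf2.SplitBadTwoRankOneOfFacts` (stmt-BirchSwinnertonDyer-20368), road α v9.1 — brick B16 file 2:
# the LOCAL KERNELS OF CONTROL at the finite places `w ∤ p` unramified in the line — `#ker ≤ #M^{I_w}`, so `≤ 2` at `w ∣ 7d`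

Cell `bsd-print-cf2`, width seat `bsd-line-cf2-p1-w3` g7 (prover-bsd-line-cf2-p1-w3-g7-0); brick B16 of LEAD g11's 18:21:06Z DE-DUP
(«LOCAL COKERNEL KERNELS OF CONTROL at the places `w ∤ 2`»); `--supports stmt-BirchSwinnertonDyer-20368` (helper, Theses-free). HONEST
FRAMING: nothing here closes the crux or a registered stub; BSD is not proved by any of this; no summit statement is proved by this
seat. No definition, no named fact, no `sorry`.

WHAT. In -w7's control skeleton (`…RestrictedSelmerControlSkeleton`, p649994) the cokernel of Agboola's control map
`𝔖_𝔮(K, M) → 𝔖_𝔮(K_∞, M)^Γ` is LOCAL: a lift `x ∈ H¹(K, M)` of an invariant class has local classes in the LOCAL KERNELS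
`ker (H¹(H_0 ⊓ D_w, M) → H¹(H_∞ ⊓ D_w, M))` (`resOfLe_local_lift_eq_zero`; `H_0 = κ.layerSubgroup 0`, `H_∞ = ker κ`,
`D_w = GreenbergSelmer.decomp w`). This file BOUNDS those kernels at the finite places `w` that are UNRAMIFIED in the line
(`I_w ≤ ker κ`, e.g. every `w ≠ v̄` for `κ'` unramified outside `v̄`), for an ARBITRARY discrete `Γ_K`-module `M` with continuous
orbit maps:
* §1 `exists_generator_decomp` — the decomposition group `D_w` is topologically generated by `I_w` and ONE element (the image of a
  local arithmetic Frobenius, `exists_isArithFrobAt_localAbsIntegers` + `eq_top_of_isOpen_of_frobenius_mem_of_inertia_le`, pulled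
  back along `Γ_{K_w} → D_w`); `normal_inertia_subgroupOf` (`I_w ⊴ D_w`).
* §2 **`finite_localControlKer_and_card_le`** — if `I_w ≤ ker κ` and `M^{I_w}` is finite, the local kernel at `w` (layer `0`) is FINITE with
  `# ≤ #M^{I_w}`: it lies in `ker (H¹(H_0 ⊓ D_w, M) → H¹(I_w, M)) ≅ H¹(D_w/I_w, M^{I_w}) ↪ M^{I_w}/(F − 1)` (the tree's generic
  inflation–restriction embedding `ResKernel.finite_subgroupResKer` run INSIDE `↥(H_0 ⊓ D_w)` with `N = I_w`, `γ = F`); and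
  `localControlKer_eq_bot_of_decomp_le` — it VANISHES when `w` splits completely in `K_∞` (`D_w ≤ ker κ`).
* §3 ROAD α (`M = W* = ↥((W.baseChange K).endEigenPrimaryTorsion 2 π r)`, `p = 2`): at every ADDITIVE `w ∤ 2` with `I_w ≤ ker κ'` the local
  kernel has **at most `2` elements** (`natCard_localControlKer_le_two_of_hasAdditiveReductionAt`; `#W*^{I_w} = 2` by file 1
  `natCard_fixedPoints_inertia_eq_two_of_hasAdditiveReductionAt`), in particular at the place above `7` on every S3c₂ frame
  (`natCard_localControlKer_seven_of_frame_le_two`, no `θ`-binder) — «one unit per prime of `K` above `ℓ ∣ 7d`» is an UPPER bound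
  `v₂ ≤ 1` per such place. The places above `2` (`v`: relaxed, no condition; `v̄`: strict — B15) and the GOOD places `w ∤ 2·7d` (where
  the kernel vanishes: `Frob_w − 1` onto on the divisible `W*`, Greenberg Lemma 3.3 — file 3) are not treated here.
presearch: Greenberg LNM 1716 §3 Lemmas 3.1–3.3 (pp. 86–88), Agboola 2007 §3 Prop. 3.2, Neukirch ANT II (9.9) — held; the tree has the
`E[p^∞]`-version in `localTowerKer` currency (`Greenberg1999/ControlLocalKernelsLayer*`); this is the `Γ_K`-subgroup currency of -w7's
skeleton for an arbitrary summand `M`. beyond-print theorem: no.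

References: [GreenbergLNM1716] §3 Lemmas 3.1, 3.2, 3.3; [Agboola2007] §3 Prop. 3.2; [NeukirchANT1999] Ch. II (9.3), (9.9);
[SerreLocalFields1979] VII §5 Prop. 3.
-/

noncomputable section

open scoped Classical NNReal

set_option linter.dupNamespace false
set_option autoImplicit false

open NumberField IsDedekindDomain Field WeierstrassCurve
open Literature.NumberTheory.EllipticCurves Literature.NumberTheory.EllipticCurves.GreenbergSelmer
open Literature.NumberTheory.EllipticCurves.Agboola2007
open Literature.NumberTheory.EllipticCurves.IwasawaDual
open Literature.NumberTheory.EllipticCurves.ResKernel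
open Literature.NumberTheory.GaloisRepresentations
open IsDedekindDomain.HeightOneSpectrum

universe u

namespace Summit.BirchSwinnertonDyer.BirchSwinnertonDyer.Theorems.PrintCf2.RestrictedSelmerPair

/-! ## §1. `D_w` is topologically generated by `I_w` and a Frobenius; `I_w ⊴ D_w` -/

section Generation

variable {K : Type u} [Field K] [NumberField K] (w : HeightOneSpectrum (𝓞 K))

/-- **`D_w` is topologically generated by `I_w` and one element.** For every subgroup `D` of `Γ_K` squeezed between `decomp w` and
itself (e.g. `κ.layerSubgroup 0 ⊓ decomp w`), there is `F ∈ D` — the image of a local arithmetic Frobenius under `Γ_{K_w} → Γ_K` —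
such that every OPEN subgroup of `↥D` containing `I_w` and `F` is everything (pull back along `Γ_{K_w} ↠ D` and use the tree's
`eq_top_of_isOpen_of_frobenius_mem_of_inertia_le`, Neukirch II (9.9)). [cite: NeukirchANT1999, Ch. II §9 Prop. (9.9)]
[cite: SerreLocalFields1979, VII §5 Prop. 3] -/
theorem exists_generator_decomp {D : Subgroup (absoluteGaloisGroup K)} (hD : D ≤ decomp w) (hD' : decomp w ≤ D) :
    ∃ F : ↥D, ∀ U : Subgroup ↥D, IsOpen (U : Set ↥D) → (GreenbergSelmer.inertia w).subgroupOf D ≤ U → F ∈ U → U = ⊤ := by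
  obtain ⟨ν, hν⟩ := w.exists_spectralValuation
  obtain ⟨𝔐, h𝔐⟩ := w.localPrimesAbove_nonempty
  obtain ⟨Frob, hFrob⟩ := w.exists_isArithFrobAt_localAbsIntegers h𝔐
  let φ : absoluteGaloisGroup (w.adicCompletion K) →* ↥D :=
    (absGaloisRestrict K (w.adicCompletion K)).toMonoidHom.codRestrict D (fun σ ↦ hD' ⟨σ, rfl⟩)
  have hφc : Continuous φ :=
    (absGaloisRestrict K (w.adicCompletion K)).continuous.subtype_mk _
  refine ⟨φ Frob, fun U hU hIU hFU ↦ ?_⟩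
  have hU' : IsOpen ((U.comap φ : Subgroup (absoluteGaloisGroup (w.adicCompletion K))) :
      Set (absoluteGaloisGroup (w.adicCompletion K))) := hU.preimage hφc
  have hI' : 𝔐.inertia (absoluteGaloisGroup (w.adicCompletion K)) ≤ U.comap φ := by
    intro σ hσ
    rw [inertia_eq_absInertia hν h𝔐] at hσ
    refine Subgroup.mem_comap.mpr (hIU ?_)
    rw [Subgroup.mem_subgroupOf]
    exact Subgroup.mem_map.mpr ⟨σ, hσ, rfl⟩
  have htop := eq_top_of_isOpen_of_frobenius_mem_of_inertia_le w h𝔐 hFrob hU' (Subgroup.mem_comap.mpr hFU) hI'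
  rw [eq_top_iff]
  rintro ⟨g, hg⟩ -
  obtain ⟨σ, hσ⟩ := (mem_decomp_iff w g).mp (hD hg)
  have hσU : σ ∈ U.comap φ := htop ▸ Subgroup.mem_top σ
  have hφσ : φ σ = ⟨g, hg⟩ := Subtype.ext hσ
  exact hφσ ▸ Subgroup.mem_comap.mp hσU

/-- **`I_w ⊴ D_w`**: the inertia group is normal in (any subgroup squeezed onto) the decomposition group — it is the image of the
normal subgroup `absInertia K_w ⊴ Γ_{K_w}` under `Γ_{K_w} ↠ D_w`. [cite: NeukirchANT1999, Ch. I §9 (Def. (9.5))] -/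
theorem normal_inertia_subgroupOf {D : Subgroup (absoluteGaloisGroup K)} (hD : D ≤ decomp w) :
    ((GreenbergSelmer.inertia w).subgroupOf D).Normal := by
  refine ⟨fun n hn g ↦ ?_⟩
  rw [Subgroup.mem_subgroupOf] at hn ⊢
  obtain ⟨σ, hσ⟩ := (mem_decomp_iff w (g : absoluteGaloisGroup K)).mp (hD g.2)
  obtain ⟨τ, hτ, hτn⟩ := Subgroup.mem_map.mp hn
  rw [Subgroup.coe_mul, Subgroup.coe_mul, Subgroup.coe_inv, ← hσ]
  refine Subgroup.mem_map.mpr ⟨σ * τ * σ⁻¹, (inferInstance : (absInertia (w.adicCompletion K)).Normal).conj_mem τ hτ σ, ?_⟩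
  rw [← hτn]
  simp only [map_mul, map_inv]
  rfl

end Generation

/-! ## §2. The local kernel of control at a place unramified in the line: `# ≤ #M^{I_w}` -/

section Generic

variable {K : Type u} [Field K] [NumberField K] {p : ℕ} [Fact p.Prime] (κ : ZpExtension K p)
  (M : Type u) [AddCommGroup M] [DistribMulAction (absoluteGaloisGroup K) M]
  [TopologicalSpace M] [DiscreteTopology M] (w : HeightOneSpectrum (𝓞 K))

/-- **THE LOCAL KERNEL OF CONTROL AT AN UNRAMIFIED PLACE IS FINITE, `# ≤ #M^{I_w}`.** `K` a number field, `κ` a `ℤ_p`-extension,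
`M` a discrete `Γ_K`-module with continuous orbit maps, `w` a finite place with `I_w ≤ ker κ` (the line is unramified at `w`) and
`M^{I_w}` finite. Then the local kernel of -w7's control skeleton at layer `0`,
`ker (H¹(H_0 ⊓ D_w, M) → H¹(H_∞ ⊓ D_w, M))` (`resOfLe_local_lift_eq_zero`), is finite of order `≤ #M^{I_w}`: its classes die on
`I_w ≤ H_∞ ⊓ D_w`, so it lies in `ker (H¹(H_0 ⊓ D_w, M) → H¹(I_w, M)) ↪ M^{I_w}/(F − 1)M^{I_w}` (`ResKernel.finite_subgroupResKer` inside
`↥(H_0 ⊓ D_w)`, generated by `I_w` and a Frobenius `F`, §1). Greenberg's `ker(r_v) ⊆ H¹(K_v^{nr}/K_v, E(K_v^{nr}))`-step for an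
arbitrary coefficient module. [cite: GreenbergLNM1716, §3 Lemma 3.3 (proof, PDF pp. 86–88)] [cite: Agboola2007, §3 Prop. 3.2] -/
theorem finite_localControlKer_and_card_le (hI : GreenbergSelmer.inertia w ≤ κ.kerSubgroup)
    (hcont : ∀ m : M, Continuous fun g : absoluteGaloisGroup K ↦ g • m)
    [Finite (FixedPoints.addSubgroup (GreenbergSelmer.inertia w) M)] :
    Finite (resOfLe M (inf_le_inf_right (decomp w) (κ.kerSubgroup_le_layerSubgroup 0) :
        κ.kerSubgroup ⊓ decomp w ≤ κ.layerSubgroup 0 ⊓ decomp w)).ker ∧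
      Nat.card (resOfLe M (inf_le_inf_right (decomp w) (κ.kerSubgroup_le_layerSubgroup 0) :
          κ.kerSubgroup ⊓ decomp w ≤ κ.layerSubgroup 0 ⊓ decomp w)).ker ≤
        Nat.card (FixedPoints.addSubgroup (GreenbergSelmer.inertia w) M) := by
  let G₀ : Subgroup (absoluteGaloisGroup K) := κ.layerSubgroup 0 ⊓ decomp w
  have hG₀D : G₀ ≤ decomp w := inf_le_right
  have hDG₀ : decomp w ≤ G₀ := fun g hg ↦ ⟨by rw [ZpExtension.layerSubgroup_zero]; trivial, hg⟩
  have hIG₀ : GreenbergSelmer.inertia w ≤ G₀ := (inertia_le_decomp w).trans hDG₀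
  let N : Subgroup ↥G₀ := (GreenbergSelmer.inertia w).subgroupOf G₀
  haveI : N.Normal := normal_inertia_subgroupOf w hG₀D
  obtain ⟨F, hgen⟩ := exists_generator_decomp w hG₀D hDG₀
  have hcont' : ∀ m : M, Continuous fun g : ↥G₀ ↦ g • m := fun m ↦ (hcont m).comp continuous_subtype_val
  -- the `N`-fixed points are the `I_w`-fixed points
  have hfix : FixedPoints.addSubgroup N M = FixedPoints.addSubgroup (GreenbergSelmer.inertia w) M := by
    ext m
    simp only [FixedPoints.mem_addSubgroup]
    constructor
    · intro h τ
      exact h ⟨⟨τ, hIG₀ τ.2⟩, Subgroup.mem_subgroupOf.mpr τ.2⟩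
    · intro h x
      exact h ⟨((x : ↥G₀) : absoluteGaloisGroup K), Subgroup.mem_subgroupOf.mp x.2⟩
  haveI : Finite (FixedPoints.addSubgroup N M) := by rw [hfix]; infer_instance
  haveI : Finite (FixedPoints.addSubgroup N M ⧸ (subOne N M F).range) := inferInstance
  obtain ⟨hfinK, hcardK⟩ := ResKernel.finite_subgroupResKer N M F hgen hcont'
  haveI := hfinK
  -- the local control kernel lies in `ker (H¹(G₀, M) → H¹(N, M))`
  have hker : (resOfLe M (inf_le_inf_right (decomp w) (κ.kerSubgroup_le_layerSubgroup 0) :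
      κ.kerSubgroup ⊓ decomp w ≤ G₀)).ker ≤ subgroupResKer M N := by
    intro c hc
    let j : ↥N →ₜ* ↥(κ.kerSubgroup ⊓ decomp w) :=
      { toFun := fun x ↦ ⟨((x : ↥G₀) : absoluteGaloisGroup K),
          ⟨hI (Subgroup.mem_subgroupOf.mp x.2), hG₀D (x : ↥G₀).2⟩⟩
        map_one' := rfl
        map_mul' := fun _ _ ↦ rfl
        continuous_toFun := (continuous_subtype_val.comp continuous_subtype_val).subtype_mk _ }
    have hcomp : (resH1Hom j (AddMonoidHom.id M) (fun _ _ ↦ rfl)).comp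
        (resOfLe M (inf_le_inf_right (decomp w) (κ.kerSubgroup_le_layerSubgroup 0) :
          κ.kerSubgroup ⊓ decomp w ≤ G₀)) = resSubgroup N M := by
      unfold Literature.NumberTheory.EllipticCurves.resOfLe ResKernel.resSubgroup
      rw [resH1Hom_comp]
      exact resH1Hom_congr (ContinuousMonoidHom.ext fun _ ↦ rfl) (AddMonoidHom.ext fun _ ↦ rfl) _ _
    rw [mem_subgroupResKer_iff, ← hcomp, AddMonoidHom.comp_apply, (AddMonoidHom.mem_ker).mp hc, map_zero]
  have hinj := AddSubgroup.inclusion_injective hker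
  refine ⟨Finite.of_injective _ hinj, (Nat.card_le_card_of_injective _ hinj).trans (hcardK.trans ?_)⟩
  calc Nat.card (FixedPoints.addSubgroup N M ⧸ (subOne N M F).range)
      ≤ Nat.card (FixedPoints.addSubgroup N M) := natCard_quotient_le _
    _ = Nat.card (FixedPoints.addSubgroup (GreenbergSelmer.inertia w) M) :=
        congrArg (fun A : AddSubgroup M ↦ Nat.card A) hfix

/-- **The local kernel VANISHES when `w` splits completely in `K_∞`** (`D_w ≤ ker κ`; in particular at the archimedean places of a
`ℤ_p`-extension, and at every finite place whose decomposition group dies in `Γ`): then `H_∞ ⊓ D_w = H_0 ⊓ D_w` and the restriction is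
injective (`resOfLe_injective_of_ge`). Greenberg: "`v` splits completely in `F_∞/F` … thus `ker(r_{v_n}) = 0`".
[cite: GreenbergLNM1716, §3 p. 86] -/
theorem localControlKer_eq_bot_of_decomp_le (hD : decomp w ≤ κ.kerSubgroup) :
    (resOfLe M (inf_le_inf_right (decomp w) (κ.kerSubgroup_le_layerSubgroup 0) :
        κ.kerSubgroup ⊓ decomp w ≤ κ.layerSubgroup 0 ⊓ decomp w)).ker = ⊥ := by
  rw [AddMonoidHom.ker_eq_bot_iff]
  exact resOfLe_injective_of_ge M _ fun g hg ↦ ⟨hD hg.2, hg.2⟩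

end Generic

/-! ## §3. Road α: at an additive `w ∤ 2` unramified in the line the local kernel has at most `2` elements -/

section CM

open Summit.BirchSwinnertonDyer.BirchSwinnertonDyer.Theorems.PrintCf2.AdditiveAtSeven

variable (W : WeierstrassCurve ℚ) [W.IsElliptic] {K : Type} [Field K] [NumberField K]

/-- **`#(local kernel at w) ≤ 2` for the CM summand at an ADDITIVE `w ∤ 2` unramified in the line.** `W/ℚ` with `j = −3375`,
`θ² = −7` in `K`, `π ∈ End_K(E_K)` with `π² = π − 2`, `r² = r − 2`, `M = W* = ↥((W.baseChange K).endEigenPrimaryTorsion 2 π r)`, `κ` any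
`ℤ₂`-extension of `K` with `I_w ≤ ker κ`, `w ∤ 2` additive for `W_K`: the local kernel of control at `w` is finite of order `≤ #W*^{I_w} = 2`
(§2 + file 1). [cite: GreenbergLNM1716, §3 Lemma 3.3 (p. 88)] [cite: Agboola2007, §3 Prop. 3.2] -/
theorem natCard_localControlKer_le_two_of_hasAdditiveReductionAt (hj : W.j = -3375) {θ : K} (hθ : θ ^ 2 = -7)
    (π : (W.baseChange K).endRing) (hrel : (π : AddMonoid.End (W.baseChange K).geomPoints) * π = π - 2)
    {r : ℤ_[2]} (hr : r * r = r - 2) (κ : ZpExtension K 2) {w : HeightOneSpectrum (𝓞 K)}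
    (hI : GreenbergSelmer.inertia w ≤ κ.kerSubgroup) (h2w : ((2 : ℕ) : 𝓞 K) ∉ w.asIdeal)
    (hadd : (W.baseChange K).HasAdditiveReductionAt w) :
    Finite (resOfLe ↥((W.baseChange K).endEigenPrimaryTorsion 2 π r)
        (inf_le_inf_right (decomp w) (κ.kerSubgroup_le_layerSubgroup 0) :
          κ.kerSubgroup ⊓ decomp w ≤ κ.layerSubgroup 0 ⊓ decomp w)).ker ∧
      Nat.card (resOfLe ↥((W.baseChange K).endEigenPrimaryTorsion 2 π r)
        (inf_le_inf_right (decomp w) (κ.kerSubgroup_le_layerSubgroup 0) :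
          κ.kerSubgroup ⊓ decomp w ≤ κ.layerSubgroup 0 ⊓ decomp w)).ker ≤ 2 := by
  haveI : (W.baseChange K).IsElliptic := by rw [baseChange]; infer_instance
  have h2 := natCard_fixedPoints_inertia_eq_two_of_hasAdditiveReductionAt W K hj hθ π hrel hr h2w hadd
  haveI : Finite (FixedPoints.addSubgroup (GreenbergSelmer.inertia w)
      ↥((W.baseChange K).endEigenPrimaryTorsion 2 π r)) := Nat.finite_of_card_ne_zero (by rw [h2]; norm_num)
  obtain ⟨hfin, hle⟩ := finite_localControlKer_and_card_le κ ↥((W.baseChange K).endEigenPrimaryTorsion 2 π r) w hI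
    (continuous_smul_endEigenPrimaryTorsion (W.baseChange K) 2 π r)
  exact ⟨hfin, hle.trans h2.le⟩

/-- **ROAD α, THE PLACE ABOVE `7`: the local kernel of control has at most `2` elements** on every S3c₂ frame (member
`C • W = cm7^{(d)}`, `K` imaginary quadratic, `v̄ ∣ 2`, `π ∈ End_K(E_K)` with `π² = π − 2`, `r² = r − 2`, `κ'` unramified outside `v̄`;
no `θ`-binder): `w₇ ≠ v̄` so `I_{w₇} ≤ ker κ'`, `W_K` is additive at `w₇` (p654052), and §3 applies — the cokernel contribution
of `w ∣ 7` to the four-index identity is `v₂ ≤ 1`. [cite: Agboola2007, §3 Prop. 3.2] [cite: GreenbergLNM1716, §3 Lemma 3.3] -/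
theorem natCard_localControlKer_seven_of_frame_le_two {d : ℤ} (hd0 : d ≠ 0) (W : WeierstrassCurve ℚ) [W.IsElliptic]
    (C : VariableChange ℚ) (hC : C • W = cm7.quadraticTwist (d : ℚ)) (hK : IsImaginaryQuadratic K)
    (vbar : HeightOneSpectrum (𝓞 K)) (hvbar : ((2 : ℕ) : 𝓞 K) ∈ vbar.asIdeal)
    (π : (W.baseChange K).endRing) (hrel : (π : AddMonoid.End (W.baseChange K).geomPoints) * π = π - 2)
    {r : ℤ_[2]} (hr : r * r = r - 2) (κ' : ZpExtension K 2) (hκ' : κ'.IsUnramifiedOutside vbar)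
    {w : HeightOneSpectrum (𝓞 K)} (h7 : ((7 : ℕ) : 𝓞 K) ∈ w.asIdeal) :
    Finite (resOfLe ↥((W.baseChange K).endEigenPrimaryTorsion 2 π r)
        (inf_le_inf_right (decomp w) (κ'.kerSubgroup_le_layerSubgroup 0) :
          κ'.kerSubgroup ⊓ decomp w ≤ κ'.layerSubgroup 0 ⊓ decomp w)).ker ∧
      Nat.card (resOfLe ↥((W.baseChange K).endEigenPrimaryTorsion 2 π r)
        (inf_le_inf_right (decomp w) (κ'.kerSubgroup_le_layerSubgroup 0) :
          κ'.kerSubgroup ⊓ decomp w ≤ κ'.layerSubgroup 0 ⊓ decomp w)).ker ≤ 2 := by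
  have hj : W.j = -3375 := j_eq_of_smul_eq_cm7Twist hd0 W C hC
  obtain ⟨θ, hθ⟩ := exists_sq_eq_neg_seven_of_cmEndo_mem_endRing W K hj π hrel
  have h2w : ((2 : ℕ) : 𝓞 K) ∉ w.asIdeal := natCast_two_notMem_of_seven_mem w h7
  have hw : w ≠ vbar := fun h ↦ h2w (h ▸ hvbar)
  exact natCard_localControlKer_le_two_of_hasAdditiveReductionAt W hj hθ π hrel hr κ' (hκ' w hw) h2w
    (hasAdditiveReductionAt_baseChange_of_j_eq_cm7_of_finrank_eq_two K w hK.1 W hj h7)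

end CM

end Summit.BirchSwinnertonDyer.BirchSwinnertonDyer.Theorems.PrintCf2.RestrictedSelmerPair

end
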